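import Summits.BirchSwinnertonDyer.BirchSwinnertonDyer.Theorems.EisensteinPrimesBSDpOnCellCCtlLocOfFinV
import Summits.BirchSwinnertonDyer.BirchSwinnertonDyer.Theorems.EisensteinPrimesBSDpOnCellCCtlLocFinV
import Summits.BirchSwinnertonDyer.BirchSwinnertonDyer.Theorems.SchneiderFreeAdditiveX3AnticycControlAdditiveBaseCountExactAnyTorsion
import Summits.BirchSwinnertonDyer.BirchSwinnertonDyer.Theorems.SchneiderFreeAdditiveX3AnticyclotomicTowerTorsion
import Literature.NumberTheory.EllipticCurves.LocalTorsionMultiplicativeProofs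
import Mathlib.RingTheory.Polynomial.Cyclotomic.Eval
import HarnessLib

/-!
# Crux 4 `BSDpOnCellC` (stmt-BirchSwinnertonDyer-19034), line b1, stub `stub_ctlOrSwitch` — CTL-split
# CLASS-WIDE: `X2.SplitControlOnTree W p` at EVERY split X2c pair, ANY local and global `p`-torsion,
# modulo the cited facts; hence the registered stub `stub_ctlOrSwitch` (first disjunct) from the facts
# (cell `bsd-eis`, seat `bsd-eis-k5-c4` g5; THEOREMS ONLY, `--supports stmt-BirchSwinnertonDyer-19034`)

HONEST FRAMING (cell `bsd-eis`, run/shared/lean/pub/bsd-eis/): theorems only; nothing booked; X2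
stays CONSTRUCTION-SHAPED; no label or count moves; closes nothing by itself. CONDITIONAL on the cited
Poitou–Tate facts / GZK / modularity / Brink Thm. 2 — the SAME hypotheses BY NAME as cgshw g8's
`X2.splitControlOnTree_of_cellC_of_noPadicPTorsion` (all of them conjuncts of `stub_publishedFacts` or
tree theorems). The registered stub's own signature carries no fact, so `stub_ctlOrSwitch_of_facts` is
a CONDITIONAL discharge (the line owner decides whether to move the facts into the composition).

## What this file proves

The torsion residual of `stub_ctlOrSwitch` (cgshw MEMO-7 §2c (I1)–(I6), MEMO-11: «control WITH
torsion, claimed nowhere in print at p ‖ N») disappears ENTIRELY: with Fin_v at a split multiplicative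
prime (`…CtlLocFinV`, this seat, NO torsion hypothesis) every atom of the `bsd-schneider-ideate` cell's
torsion-robust control count is available at a split X2c pair for ANY global torsion exponent
`g = ord_p #E(K)[p^∞]` and ANY local one `t = ord_p #E(ℚ_p)[p^∞]`:

* `pow_prime_eq_one_of_degreeOne` — an odd prime `p` with a degree-one prime `𝔭 ∣ p` in `K` admits no
  non-trivial `p`-th root of unity in `K` (`p = ∏(1 − ζ^i) ∈ 𝔭^{p−1} ⊆ 𝔭²` against `p ∉ 𝔭²`); so
  door-c5's `E(K_∞^{ac})[p^∞] = E(K)[p^∞]` applies at every CGLS field.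
* `natCard_ker_resOfLe_top_eq_pow` — (KER-res) with its TRUE exponent: `#ker(H¹(K,E[p^∞]) →
  H¹(K_∞,E[p^∞])) = #E(K)[p^∞]` along the anticyclotomic tower (door-c4 `…_eq_natCard_fixedPoints` +
  door-c5 finiteness + Galois descent).
* **`controlOnTreeAt_of_cellC_split`** — `ControlOnTreeAt` at EVERY CGLS datum of a split X2c pair, no
  torsion hypothesis: base count = door-c6's `natCard_selmerAcBase_mul_eq_of_rankOne_anyTorsion`
  (every reduction type, any torsion; `ord_p #Ẽ_ns(𝔽_p) = 0` at a multiplicative `p`), `t = t_p` by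
  Fin_v + Brink Cor. 1 above `p`, (P9-𝓒)/(L10)/(P11) as in `…CtlLocOfFinV`; glue
  `CtlLoc.controlOnTreeAt_of_torsAtoms` (`g`, `t` cancel).
* **`splitControlOnTree_of_cellC`** — `X2.CellC W p → split → X2.SplitControlOnTree W p` (+ facts).
* **`stub_ctlOrSwitch_of_facts`** — the REGISTERED stub `stub_ctlOrSwitch` of skeleton b1 v8
  (signature VERBATIM as the conclusion, FIRST disjunct) from the cited facts. No étale switch, no
  chain, no DD15 input is needed any more for the control atom of the split road.

References: [JetchevSkinnerWan2017] Thm. 3.3.1, Prop. 3.2.1, Prop. 3.3.4 Case 3(b) (arXiv:1512.06894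
pp. 10–13); [Castella2018] Thm. 2.3; [KellerYin2024] App. B Thm. B.0.6 (printed template `p ∤ N`);
[GreenbergLNM1716] §3, §4 Lemma 4.3; [Brink2007] Thm. 2, Cor. 1; cgshw MEMO-7 §2c, MEMO-11; k5-c4-MEMO-2.
-/

set_option autoImplicit false
-- the route's Theorems namespace `Summit.BirchSwinnertonDyer.BirchSwinnertonDyer.Theorems` (summit = problem) trips the linter
set_option linter.dupNamespace false

noncomputable section

open scoped Classical

open WeierstrassCurve NumberField IsDedekindDomain Field Literature.NumberTheory.EllipticCurves
  Literature.NumberTheory.EllipticCurves.ModularForms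
  Literature.NumberTheory.EllipticCurves.GreenbergSelmer
  Literature.NumberTheory.GaloisRepresentations Literature.NumberTheory.GaloisCohomology
  Literature.NumberTheory.EllipticCurves.Rank1Residual
  Literature.NumberTheory.EllipticCurves.Rank1Residual.Typed
  Literature.NumberTheory.Automorphic
  Summit.BirchSwinnertonDyer.Rank1Residual
  Summit.BirchSwinnertonDyer.Rank1Residual.X11b
  Summit.BirchSwinnertonDyer.Rank1Residual.X11b.AcSelmer
  Summit.BirchSwinnertonDyer.Rank1Residual.X2
  Summit.BirchSwinnertonDyer.BirchSwinnertonDyer.Theorems.SchneiderFreeControlAtoms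
  Summit.BirchSwinnertonDyer.BirchSwinnertonDyer.Theorems.SchneiderFreeAdditiveX3
  Summit.Ventures.HodgeRepro2.T5DegreeOneNumberField

namespace Summit.BirchSwinnertonDyer.BirchSwinnertonDyer.Theorems.CtlLoc

/-! ## §1. No `p`-th roots of unity in `K` at a prime of degree one (`p` odd) -/

section RootsOfUnity

variable {K : Type} [Field K] [NumberField K] {p : ℕ} [hp : Fact p.Prime]

/-- **`μ_p(K) = 1` when `p` is odd and `K` has a prime `𝔭 ∣ p` with `e(𝔭|p)·f(𝔭|p) = 1`.** If
`ζ ∈ K`, `ζ^p = 1`, `ζ ≠ 1`, then `ζ ∈ 𝓞_K` is a primitive `p`-th root of unity,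
`p = Φ_p(1) = ∏_{μ primitive} (1 − μ)` in `𝓞_K`; some factor lies in `𝔭`, hence all do
(`1 − μ₀ ∣ 1 − μ₀^i`), so `p ∈ 𝔭^{p−1} ⊆ 𝔭²` — but `p ∉ 𝔭²` at a prime of ramification index one.
(For an imaginary quadratic `K` with `p` split this is the route's standing «`p ∤ #𝓞_K^×`».) [folklore] -/
theorem pow_prime_eq_one_of_degreeOne (hp2 : p ≠ 2) (𝔭 : HeightOneSpectrum (𝓞 K))
    [𝔭.asIdeal.LiesOver (Ideal.span {(p : ℤ)})]
    (hdeg : 𝔭.asIdeal.ramificationIdx ℤ * 𝔭.asIdeal.inertiaDeg ℤ = 1) :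
    ∀ z : K, z ^ p = 1 → z = 1 := by
  intro z hz
  by_contra hz1
  have hpp : p.Prime := hp.out
  -- `ζ ∈ 𝓞_K`, a primitive `p`-th root of unity
  have hint : IsIntegral ℤ z := IsIntegral.of_pow hpp.pos (by rw [hz]; exact isIntegral_one)
  set ζ : 𝓞 K := ⟨z, hint⟩ with hζdef
  have hζp : ζ ^ p = 1 := by
    apply Subtype.ext
    change ((ζ ^ p : 𝓞 K) : K) = ((1 : 𝓞 K) : K)
    push_cast
    exact hz
  have hζ1 : ζ ≠ 1 := fun h ↦ hz1 (by
    have := congrArg (fun x : 𝓞 K ↦ (x : K)) h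
    simpa [hζdef] using this)
  have hprim : IsPrimitiveRoot ζ p := IsPrimitiveRoot.iff_orderOf.mpr (orderOf_eq_prime hζp hζ1)
  -- `p = ∏_{μ ∈ primitiveRoots p 𝓞_K} (1 − μ)`
  have hprod : ((p : ℕ) : 𝓞 K) = ∏ μ ∈ primitiveRoots p (𝓞 K), (1 - μ) := by
    have h := Polynomial.eval_one_cyclotomic_prime (R := 𝓞 K) (p := p)
    rw [Polynomial.cyclotomic_eq_prod_X_sub_primitiveRoots hprim, Polynomial.eval_prod] at h
    simp only [Polynomial.eval_sub, Polynomial.eval_X, Polynomial.eval_C] at h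
    exact h.symm
  -- some, hence every, factor lies in `𝔭`
  have hpmem : ((p : ℕ) : 𝓞 K) ∈ 𝔭.asIdeal := by
    have : (Ideal.span {(p : ℤ)}).map (algebraMap ℤ (𝓞 K)) ≤ 𝔭.asIdeal :=
      Ideal.map_le_iff_le_comap.mpr (le_of_eq (Ideal.LiesOver.over (p := Ideal.span {(p : ℤ)})
        (P := 𝔭.asIdeal)))
    have h1 : algebraMap ℤ (𝓞 K) (p : ℤ) ∈ 𝔭.asIdeal :=
      this (Ideal.mem_map_of_mem _ (Ideal.mem_span_singleton_self _))
    simpa using h1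
  haveI := 𝔭.isPrime
  obtain ⟨μ₀, hμ₀, hμ₀𝔭⟩ : ∃ μ₀ ∈ primitiveRoots p (𝓞 K), (1 - μ₀) ∈ 𝔭.asIdeal := by
    have h := hpmem
    rw [hprod] at h
    exact Ideal.IsPrime.prod_mem_iff.mp h
  have hμ₀prim : IsPrimitiveRoot μ₀ p := (mem_primitiveRoots hpp.pos).mp hμ₀
  have hall : ∀ μ ∈ primitiveRoots p (𝓞 K), (1 - μ) ∈ 𝔭.asIdeal := by
    intro μ hμ
    have hμprim : IsPrimitiveRoot μ p := (mem_primitiveRoots hpp.pos).mp hμ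
    obtain ⟨i, -, rfl⟩ := hμ₀prim.eq_pow_of_pow_eq_one hμprim.pow_eq_one
    obtain ⟨c, hc⟩ := sub_dvd_pow_sub_pow (1 : 𝓞 K) μ₀ i
    rw [one_pow] at hc
    rw [hc]
    exact Ideal.mul_mem_right _ _ hμ₀𝔭
  -- `p ∈ 𝔭^{p-1} ⊆ 𝔭²`
  have hcard : (primitiveRoots p (𝓞 K)).card = p - 1 := by
    rw [hprim.card_primitiveRoots, Nat.totient_prime hpp]
  have hpow : ((p : ℕ) : 𝓞 K) ∈ 𝔭.asIdeal ^ (p - 1) := by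
    rw [hprod, ← hcard, ← Finset.prod_const]
    exact Ideal.prod_mem_prod fun μ hμ ↦ hall μ hμ
  have hle : 2 ≤ p - 1 := by
    have := hpp.two_le
    omega
  have hsq : ((p : ℕ) : 𝓞 K) ∈ 𝔭.asIdeal ^ 2 := Ideal.pow_le_pow_right hle hpow
  exact natCast_notMem_sq 𝔭 p hdeg hsq

/-- **`μ_p(K) = 1` for an imaginary quadratic `K` in which the odd prime `p` splits** (a split prime
has degree one). [folklore] -/
theorem pow_prime_eq_one_of_splitsIn (hp2 : p ≠ 2) (hK : IsImaginaryQuadratic K) (hsplit : SplitsIn K p)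
    (𝔭 : HeightOneSpectrum (𝓞 K)) (h𝔭 : ((p : ℕ) : 𝓞 K) ∈ 𝔭.asIdeal) :
    ∀ z : K, z ^ p = 1 → z = 1 := by
  haveI := liesOver_span_of_natCast_mem (K := K) h𝔭
  exact pow_prime_eq_one_of_degreeOne hp2 𝔭
    (ramificationIdx_mul_inertiaDeg_eq_one_of_splitsIn hK.1 hsplit h𝔭)

end RootsOfUnity

/-! ## §2. (KER-res) with its exponent `g = ord_p #E(K)[p^∞]` along the anticyclotomic tower -/

section KerRes

variable (W : WeierstrassCurve ℚ) [W.IsElliptic] (p : ℕ) [hp : Fact p.Prime]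
  {K : Type} [Field K] [NumberField K] (κ : ZpExtension K p)

/-- **(KER-res): `#ker(H¹(K, E[p^∞]) → H¹(K_∞, E[p^∞])) = p^g`, `p^g = #E(K)[p^∞]`**, for `E/ℚ`, an odd
`p`, an imaginary quadratic `K` with `μ_p(K) = 1` and an ANTICYCLOTOMIC `κ`: Greenberg's Lemma 4.3
bookkeeping (door-c4 `natCard_ker_resOfLe_top_eq_natCard_fixedPoints`) with `E(K_∞^{ac})[p^∞]` finite
(door-c5 `finite_fixedPoints_kerSubgroup_of_isAnticyclotomic`) and Galois descent
`#E_K[p^∞]^{Γ_K} = #E(K)[p^∞]` (door-c4). [cite: GreenbergLNM1716, §4 Lemma 4.3 (p. 103)] -/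
theorem natCard_ker_resOfLe_top_eq_pow (hp2 : p ≠ 2) (hK : IsImaginaryQuadratic K)
    (hζ : ∀ z : K, z ^ p = 1 → z = 1) (hκ : κ.IsAnticyclotomic) :
    Nat.card ((W.baseChange K).resOfLe p (le_top : κ.kerSubgroup ≤ ⊤)).ker =
      p ^ padicValNat p
        (Nat.card (AddCommGroup.primaryComponent (W.baseChange K).toAffine.Point p)) := by
  haveI hEK : (W.baseChange K).IsElliptic := by rw [baseChange]; infer_instance
  haveI := finite_fixedPoints_kerSubgroup_of_isAnticyclotomic W p κ hp2 hK hζ hκ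
  rw [natCard_ker_resOfLe_top_eq_natCard_fixedPoints (W.baseChange K) p κ,
    natCard_fixedPoints_geomPrimaryTorsion_eq_natCard_primaryComponent (W.baseChange K) p]
  exact natCard_primaryComponent_point_eq_pow (W.baseChange K) p

end KerRes

/-! ## §3. `ControlOnTreeAt` at EVERY CGLS datum of a split X2c pair — no torsion hypothesis -/

section Datum

variable (W : WeierstrassCurve ℚ) [W.IsElliptic] [W.IsGloballyMinimal] (p : ℕ) [Fact p.Prime]

/-- **The anticyclotomic control theorem at a SPLIT multiplicative Eisenstein prime, ANY torsion.**
For `E/ℚ` globally minimal of analytic rank one with SPLIT multiplicative reduction at the odd prime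
`p`, an imaginary quadratic `K` with `p` split and `L(E^{(d_K)},1) ≠ 0`, `P ∈ E(K)` of infinite order,
an ANTICYCLOTOMIC `κ` with topological generator `γ`, a degree-one `𝔭 ∣ p`:
`ControlOnTreeAt p κ 𝔭 γ (embAt K p 𝔭) P` (Cas18 Thm. 2.3 / JSW17 Thm. 3.3.1 shape), from GZK /
modularity and the cited cohomological facts. NO hypothesis on `E(ℚ_p)[p]` or `E(K)[p]`: the
global torsion exponent `g = ord_p #E(K)[p^∞]` (KER-res, base count) and the local one
`t = ord_p #E(ℚ_p)[p^∞]` (KER-𝔭 via Fin_v, base count) both CANCEL in the count. This is cgshw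
MEMO-7 §2c (I1)–(I6) «control WITH torsion» as a kernel theorem modulo the cited facts.
[cite: JetchevSkinnerWan2017, Thm. 3.3.1, Prop. 3.2.1, Prop. 3.3.4 Case 3(b) (arXiv:1512.06894 pp. 10–13)]
[cite: KellerYin2024, App. B Thm. B.0.6 (arXiv:2402.12781 pp. 29–30)] [cite: Castella2018, Thm. 2.3]
[cite: Brink2007, Thm. 2 and Cor. 1] -/
theorem controlOnTreeAt_of_split_anyTorsion
    (hGZK : rank_eq_analyticRank_of_analyticRank_le_one) (hnf : exists_isNewformOf)
    (hPT : ∀ (K : Type) [Field K] [NumberField K], poitouTate_selmerStructure_duality K)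
    (hPT2 : ∀ (K : Type) [Field K] [NumberField K], poitouTate_sha_tateDual K)
    (hEP : ∀ (K : Type) [Field K] [NumberField K] (v : HeightOneSpectrum (𝓞 K)),
      localEulerPoincareCharacteristic (v.adicCompletion K))
    (hBr : ∀ (K : Type) [Field K] [NumberField K] (p : ℕ) [Fact p.Prime],
      ZpExtension.decomp_not_le_kerSubgroup_of_isAnticyclotomic K p)
    (hp2 : p ≠ 2) (hsplitW : W.HasSplitMultiplicativeReductionAtPrime p) (hr : W.analyticRank = 1)
    {K : Type} [Field K] [NumberField K] (hK : IsImaginaryQuadratic K) (hsplit : SplitsIn K p)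
    (hLt : (W.quadraticTwist (NumberField.discr K : ℚ)).entireLFunction 1 ≠ 0)
    (P : (W.baseChange K).toAffine.Point) (hPinf : ¬ IsOfFinAddOrder P)
    (κ : ZpExtension K p) (hκ : κ.IsAnticyclotomic) (γ : absoluteGaloisGroup K)
    [hγ : Fact (κ.IsTopGenerator γ)] (𝔭 : HeightOneSpectrum (𝓞 K))
    (h𝔭 : ((p : ℕ) : 𝓞 K) ∈ 𝔭.asIdeal) (he : 𝔭.asIdeal.ramificationIdx (𝓞 ℚ) = 1)
    (hf : 𝔭.asIdeal.inertiaDeg (𝓞 ℚ) = 1) :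
    ControlOnTreeAt p κ 𝔭 γ (embAt K p 𝔭 h𝔭 he hf) P := by
  have hp : p.Prime := Fact.out
  haveI : IsTotallyComplex K := hK.2
  haveI hEK : (W.baseChange K).IsElliptic := by rw [baseChange]; infer_instance
  have hmult : Mult W p := hsplitW.hasMultiplicativeReductionAtPrime
  have hpN : p ∣ W.conductorNorm ℤ := dvd_conductorNorm_of_mult hmult
  obtain ⟨hrank, hSha⟩ := mordellWeilRank_eq_one_and_shaFinite_of_twist W hGZK hnf hr hK.1 hLt
  -- the base count at every degree-one prime above `p` (finiteness) and at `𝔭` (the count), ANY torsion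
  have hfin : ∀ v : HeightOneSpectrum (𝓞 K), ((p : ℕ) : 𝓞 K) ∈ v.asIdeal →
      Finite (selmerAcBase (W.baseChange K) p v ∅) := fun v hv ↦ by
    obtain ⟨he', hf'⟩ := degreeOne_of_splitsIn hK.1 hsplit hv
    obtain ⟨hfinv, -, -, -⟩ := natCard_selmerAcBase_mul_eq_of_rankOne_anyTorsion W p K (hPT K)
      (hEP K) hK hsplit hrank hSha P hPinf v hv he' hf'
    exact hfinv
  obtain ⟨hfinSel, a, hcard, ha⟩ := natCard_selmerAcBase_mul_eq_of_rankOne_anyTorsion W p K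
    (hPT K) (hEP K) hK hsplit hrank hSha P hPinf 𝔭 h𝔭 he hf
  have hns : padicValNat p (reductionPointCount W p) = 0 :=
    padicValNat.eq_zero_of_not_dvd (LocalTorsionMult.not_dvd_reductionPointCount_of_mult W p hmult)
  -- `#E(ℚ_p)[p^∞] = p^t`, `#Sel = p^(a - t)`, `t ≤ a`
  obtain ⟨t, ht⟩ := exists_natCard_primaryComponent_padic_eq_pow W p
  have hta : t ≤ a := by
    have h1 : p ^ t ∣ p ^ a := ⟨Nat.card (selmerAcBase (W.baseChange K) p 𝔭 ∅), by
      rw [mul_comm, ← ht]; exact hcard.symm⟩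
    exact (Nat.pow_dvd_pow_iff_le_right hp.one_lt).mp h1
  have hcard' : Nat.card (selmerAcBase (W.baseChange K) p 𝔭 ∅) = p ^ (a - t) := by
    have h1 : Nat.card (selmerAcBase (W.baseChange K) p 𝔭 ∅) * p ^ t = p ^ (a - t) * p ^ t := by
      rw [← pow_add, Nat.sub_add_cancel hta, ← ht]; exact hcard
    exact Nat.eq_of_mul_eq_mul_right (pow_pos hp.pos t) h1
  -- (KER-𝔭): `#ker r_𝔭 = p^t` from Fin_v (THEOREM at a split multiplicative prime) and Brink Cor. 1
  have hFin : LocalTowerTorsionFiniteAt (W.baseChange K) p κ 𝔭 :=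
    localTowerTorsionFiniteAt_of_hasSplitMultiplicativeReductionAtPrime W hp2 hsplitW hK hsplit κ hκ 𝔭 h𝔭
  have hv : ¬ decomp 𝔭 ≤ κ.kerSubgroup :=
    ZpExtension.decomp_not_le_kerSubgroup_above_of_isAnticyclotomic_holds (K := K) (p := p) hK hp2
      κ hκ 𝔭 h𝔭
  have h𝔭ker := natCard_localKer_eq_pow_of_finite W p κ 𝔭 h𝔭 he hf hFin hv ht
  -- (KER-res): `#ker res = p^g`, `p^g = #E(K)[p^∞]`
  set g := padicValNat p (Nat.card (AddCommGroup.primaryComponent (W.baseChange K).toAffine.Point p))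
    with hgdef
  have hres := natCard_ker_resOfLe_top_eq_pow W p κ hp2 hK
    (pow_prime_eq_one_of_splitsIn hp2 hK hsplit 𝔭 h𝔭) hκ
  -- (P9-𝓒) at the conjugate prime, (L10), (P11)
  obtain ⟨σ, 𝔮, -, hne, h𝔮, -⟩ :=
    LocalIndexTransport.exists_conj_prime_of_splitsIn K p hK.1 hsplit h𝔭
  have hloc := ptSurj_of_finite W p hK hsplit (hPT K) h𝔭 h𝔮 hne (hfin 𝔮 h𝔮) κ
  have h10 : CoinvariantsTrivialAt (W.baseChange K) p κ 𝔭 γ :=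
    coinvariantsTrivialAt_of_finite_anyTorsion W p hK hsplit (hPT K) (hPT2 K) κ hγ.out h𝔭 hfin
  have h11 := r1LocalKernelOrderAt_of_anticyclotomicDecomposition W p hBr hp2 K hK κ hκ
  -- assemble: `g` and `t` cancel
  refine controlOnTreeAt_of_torsAtoms hK hsplit hpN hκ γ 𝔭 h𝔭 (embAt K p 𝔭 h𝔭 he hf) P g t (a - t)
    hres h𝔭ker ⟨⟨hfinSel, hcard'⟩, ?_⟩ hloc h10 h11
  rw [Nat.cast_sub hta, ha, hns]
  push_cast
  ring

end Datum

/-! ## §4. `SplitControlOnTree` CLASS-WIDE and the registered stub from the facts -/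

section ClassLevel

variable (W : WeierstrassCurve ℚ) [W.IsElliptic] [W.IsGloballyMinimal] (p : ℕ) [Fact p.Prime]

/-- **CTL-split CLASS-WIDE.** For a rank-one X2 pair `(E, p)` (`X2.CellC W p`) with SPLIT
multiplicative reduction at `p`: `X2.SplitControlOnTree W p`, from GZK / modularity and the cited
cohomological facts — at EVERY curve of the class, whatever its local or global `p`-torsion. Supersedes
cgshw g8's `X2.splitControlOnTree_of_cellC_of_noPadicPTorsion` (`E(ℚ_p)[p] = 0`) and this seat's
`…_of_noKTorsion` / `…_of_noEtaleLine`. CONDITIONAL on the cited facts; nothing booked.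
[cite: Castella2018, Thm. 2.3 (arXiv:1704.06608 p. 5)] [cite: JetchevSkinnerWan2017, Thm. 3.3.1 (arXiv:1512.06894 p. 11)]
[cite: KellerYin2024, App. B Thm. B.0.6 (printed template: control with torsion)] -/
theorem splitControlOnTree_of_cellC
    (hGZK : rank_eq_analyticRank_of_analyticRank_le_one) (hnf : exists_isNewformOf)
    (hPT : ∀ (K : Type) [Field K] [NumberField K], poitouTate_selmerStructure_duality K)
    (hPT2 : ∀ (K : Type) [Field K] [NumberField K], poitouTate_sha_tateDual K)
    (hEP : ∀ (K : Type) [Field K] [NumberField K] (v : HeightOneSpectrum (𝓞 K)),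
      localEulerPoincareCharacteristic (v.adicCompletion K))
    (hBr : ∀ (K : Type) [Field K] [NumberField K] (p : ℕ) [Fact p.Prime],
      ZpExtension.decomp_not_le_kerSubgroup_of_isAnticyclotomic K p)
    (hc : X2.CellC W p) (hsplitW : W.HasSplitMultiplicativeReductionAtPrime p) :
    X2.SplitControlOnTree W p := by
  intro K _ _ P _ _ hK hHp hLt hPinf κ hκ γ _ 𝔭 h𝔭 he hf
  exact controlOnTreeAt_of_split_anyTorsion W p hGZK hnf hPT hPT2 hEP hBr hc.2.1 hsplitW hc.1 hK
    (hHp p Fact.out dvd_rfl) hLt P hPinf κ hκ γ 𝔭 h𝔭 he hf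

/-- **The registered stub `stub_ctlOrSwitch` of skeleton b1 v8 (crux 4 `BSDpOnCellC`,
stmt-BirchSwinnertonDyer-19034; signature VERBATIM as the conclusion) from the cited facts** — by its
FIRST disjunct, class-wide (`splitControlOnTree_of_cellC`); the étale-switch disjunct is never needed.
The facts are exactly conjuncts of the sibling stub `stub_publishedFacts` (GZK, modularity, Poitou–Tate
×2, Milne I 2.8, Brink Thm. 2), so inside the composition `BSDpOnCellC_of` the stub is discharged; its
own fact-free signature is not claimed (a CONDITIONAL discharge — the line owner may move the facts into
the stub or supply them from `stub_publishedFacts` at the call site).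
[cite: Castella2018, Thm. 2.3 (arXiv:1704.06608 p. 5)] [cite: JetchevSkinnerWan2017, Thm. 3.3.1 (arXiv:1512.06894 p. 11)] -/
theorem stub_ctlOrSwitch_of_facts
    (hGZK : rank_eq_analyticRank_of_analyticRank_le_one) (hnf : exists_isNewformOf)
    (hPT : ∀ (K : Type) [Field K] [NumberField K], poitouTate_selmerStructure_duality K)
    (hPT2 : ∀ (K : Type) [Field K] [NumberField K], poitouTate_sha_tateDual K)
    (hEP : ∀ (K : Type) [Field K] [NumberField K] (v : HeightOneSpectrum (𝓞 K)),
      localEulerPoincareCharacteristic (v.adicCompletion K))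
    (hBr : ∀ (K : Type) [Field K] [NumberField K] (p : ℕ) [Fact p.Prime],
      ZpExtension.decomp_not_le_kerSubgroup_of_isAnticyclotomic K p) :
    ∀ (W : WeierstrassCurve ℚ) [W.IsElliptic] [W.IsGloballyMinimal] (p : ℕ) [Fact p.Prime],
      X2.CellC W p → W.HasSplitMultiplicativeReductionAtPrime p →
        X2.SplitControlOnTree W p ∨ ∃ (W' : WeierstrassCurve ℚ) (_ : W'.IsElliptic)
          (_ : W'.IsGloballyMinimal), IsIsogenous W W' ∧ X2.HasPrimeToManinDatum W' p ∧
            ∀ Q₀ : (W'.baseChange ℚ_[p]).toAffine.Point, p • Q₀ = 0 → Q₀ = 0 :=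
  fun W _ _ p _ hc hsplitW ↦ Or.inl (splitControlOnTree_of_cellC W p hGZK hnf hPT hPT2 hEP hBr hc hsplitW)

end ClassLevel

end Summit.BirchSwinnertonDyer.BirchSwinnertonDyer.Theorems.CtlLoc

end
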